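import Mathlib
import Literature.Computability.Complexity.RangeAvoidance
import Literature.Computability.Complexity.SignDegreeSimple
import HarnessLib

/-!
# Guruswami–Lyu–Wang's hitting-set principle: outputs that are all `δ`-correlated with few tests
# cannot be pairwise (almost) uncorrelated  (GLW, ACM ToCT 2025, Thm. 6 / Thm. 33 — the core inequality)

**Theorem** [Guruswami–Lyu–Wang 2025, Thm. 6 and Thm. 33 (proof, §5.1, "following the technique of
[MST06]")].  Let `φ` be a probability distribution on an input space `α`, let `Y_i : α → {±1}`
(`i ∈ ι`, `|ι| = m`) be output functions and `χ_t : α → {±1}` (`t ∈ T`) test functions.  If every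
output is `δ`-correlated under `φ` with SOME test (`|E_φ[Y_i χ_t]| ≥ δ > 0` — GLW's "(d, δ)-simple",
with `T` = the parities on `≤ d` inputs) while every two distinct outputs are nearly uncorrelated
(`|E_φ[Y_i Y_j]| ≤ 4γ`, which is what sampling a `γ`-almost pairwise independent distribution forces),
and `8γ ≤ δ²`, then `m·δ² ≤ 2|T|`.  Contrapositively (GLW Thm. 6): with `m > 2|T|/δ²` outputs, `C(φ)`
is not `γ`-almost pairwise independent for ANY input distribution `φ` — whence (GLW Thm. 33) the support
of any `γ`-almost pairwise independent distribution on `{0,1}^m` is a HITTING SET for `AVOID(C)`.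
Proof as printed: group the outputs by their test; inside a group of size `N` the signed sum `Z` has
`E[Zχ_t] ≥ Nδ`, `E[Zχ_t]² ≤ E[Z²] ≤ N + 4γN(N−1)` (second moment), so `Nδ² ≤ 2`; sum over the groups.
(GLW state the count for `T` = parity tests on at most `d` of `n` inputs, `|T| ≤ n^d`, as
"`m > (2/ε²)·n^d`", with their normalisation `3ε²/8` of almost pairwise independence; the constants here
are the ones this three-line argument gives.)

* `wexpect` — `E_φ[g] = Σ_x φ(x)·g(x)`;
* `sq_wexpect_mul_le` — `E[Zχ]² ≤ E[Z²]` for a `±1`-valued `χ` (the Cauchy–Schwarz step);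
* `card_mul_sq_le_of_correlated_of_pairwise` — **the theorem** `m·δ² ≤ 2·|T|`;
* `exists_mem_support_not_mem_range` — the hitting-set form (Thm. 33, abstract input space and tests);
* `LocalMap.exists_mem_support_not_mem_range_of_isSimple`, `LocalMap.hittingSet_of_signDegLE` — Thm. 33
  for `k`-local maps (`LocalMap` of file `RangeAvoidance`) whose tables are `(d,δ)`-simple / have
  sign-degree `≤ d` (file `SignDegreeSimple`), tests = parities of `≤ d` input positions (last section).

## References
* V. Guruswami, X. Lyu, X. Wang, *Range Avoidance for Low-Depth Circuits and Connections to
  Pseudorandomness*, ACM ToCT 17(2) (2025), §1.3 Thm. 6, §5.1 Def. 32, Thm. 33 and its proof.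
  bib `GuruswamiLyuWang2025`.
* E. Mossel, A. Shpilka, L. Trevisan, *On ε-biased generators in NC⁰*, Random Struct. Alg. 29 (2006)
  (the second-moment technique GLW follow).
-/

namespace Literature.Computability.Complexity

open Finset

namespace GLWHitting

variable {α : Type*} [Fintype α]

/-- Expectation under weights `φ`: `E_φ[g] = Σ_x φ(x)·g(x)`. [cite: GuruswamiLyuWang2025, Def. 18 (inner product over `φ`)] -/
def wexpect (φ : α → ℚ) (g : α → ℚ) : ℚ := ∑ x, φ x * g x

/-- Linearity of `E_φ` in the integrand (finite sums). [cite: GuruswamiLyuWang2025, Def. 18] -/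
theorem wexpect_sum {κ : Type*} (s : Finset κ) (φ : α → ℚ) (g : κ → α → ℚ) :
    wexpect φ (fun x => ∑ i ∈ s, g i x) = ∑ i ∈ s, wexpect φ (g i) := by
  unfold wexpect
  rw [Finset.sum_comm]
  exact Finset.sum_congr rfl fun x _ => Finset.mul_sum _ _ _

/-- `E_φ[c·g] = c·E_φ[g]`. [cite: GuruswamiLyuWang2025, Def. 18] -/
theorem wexpect_const_mul (φ : α → ℚ) (c : ℚ) (g : α → ℚ) :
    wexpect φ (fun x => c * g x) = c * wexpect φ g := by
  unfold wexpect
  rw [Finset.mul_sum]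
  exact Finset.sum_congr rfl fun x _ => by ring

/-- Monotonicity of `E_φ` for nonnegative weights. [cite: GuruswamiLyuWang2025, Def. 18] -/
theorem wexpect_mono {φ : α → ℚ} (hφ : ∀ x, 0 ≤ φ x) {f g : α → ℚ} (h : ∀ x, f x ≤ g x) :
    wexpect φ f ≤ wexpect φ g :=
  Finset.sum_le_sum fun x _ => mul_le_mul_of_nonneg_left (h x) (hφ x)

/-- `E_φ[1] = 1` for a probability distribution. [cite: GuruswamiLyuWang2025, Def. 18] -/
theorem wexpect_one {φ : α → ℚ} (hφ1 : ∑ x, φ x = 1) : wexpect φ (fun _ => 1) = 1 := by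
  simp [wexpect, hφ1]

/-- **The Cauchy–Schwarz step**: for a `±1`-valued test `χ`, `E_φ[Z·χ]² ≤ E_φ[Z²]`
(expand `0 ≤ E_φ[(Z − E[Zχ]·χ)²]` using `χ² = 1`). [cite: GuruswamiLyuWang2025, Thm. 33 (proof)] -/
theorem sq_wexpect_mul_le {φ : α → ℚ} (hφ : ∀ x, 0 ≤ φ x) (hφ1 : ∑ x, φ x = 1) (Z χ : α → ℚ)
    (hχ : ∀ x, χ x = 1 ∨ χ x = -1) :
    (wexpect φ (fun x => Z x * χ x)) ^ 2 ≤ wexpect φ (fun x => Z x ^ 2) := by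
  set c := wexpect φ (fun x => Z x * χ x) with hc
  have hχsq : ∀ x, χ x ^ 2 = 1 := fun x => by rcases hχ x with h | h <;> simp [h]
  -- 0 ≤ E[(Z - cχ)²] = E[Z²] - 2c·E[Zχ] + c²
  have h0 : 0 ≤ wexpect φ (fun x => (Z x - c * χ x) ^ 2) :=
    Finset.sum_nonneg fun x _ => mul_nonneg (hφ x) (sq_nonneg _)
  have hexp : wexpect φ (fun x => (Z x - c * χ x) ^ 2) =
      wexpect φ (fun x => Z x ^ 2) - 2 * c * wexpect φ (fun x => Z x * χ x) + c ^ 2 := by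
    have hpt : ∀ x, (Z x - c * χ x) ^ 2 = Z x ^ 2 - 2 * c * (Z x * χ x) + c ^ 2 * 1 := by
      intro x; rw [← hχsq x]; ring
    unfold wexpect
    simp only [hpt, mul_add, mul_sub, Finset.sum_add_distrib, Finset.sum_sub_distrib]
    have h2 : (∑ x, φ x * (2 * c * (Z x * χ x))) = 2 * c * ∑ x, φ x * (Z x * χ x) := by
      rw [Finset.mul_sum]; exact Finset.sum_congr rfl fun x _ => by ring
    have h3 : (∑ x, φ x * (c ^ 2 * 1)) = c ^ 2 * ∑ x, φ x := by
      rw [Finset.mul_sum]; exact Finset.sum_congr rfl fun x _ => by ring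
    rw [h2, h3, hφ1]
    ring
  rw [hexp, ← hc] at h0
  nlinarith [h0]

variable {ι T : Type*} [Fintype ι] [Fintype T] [DecidableEq T]

/-- **GLW's core inequality** (Thm. 6 / proof of Thm. 33): if every output `Y_i` is `δ`-correlated under
`φ` with some `±1` test from `T`, every two distinct outputs satisfy `|E_φ[Y_iY_j]| ≤ 4γ`, and `8γ ≤ δ²`,
then `m·δ² ≤ 2·|T|`. [cite: GuruswamiLyuWang2025, Thm. 6 and Thm. 33 (proof)] -/
theorem card_mul_sq_le_of_correlated_of_pairwise {φ : α → ℚ} (hφ : ∀ x, 0 ≤ φ x) (hφ1 : ∑ x, φ x = 1)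
    (Y : ι → α → ℚ) (hY : ∀ i x, Y i x = 1 ∨ Y i x = -1)
    (χ : T → α → ℚ) (hχ : ∀ t x, χ t x = 1 ∨ χ t x = -1)
    {δ γ : ℚ} (hδ : 0 < δ) (hγ : 8 * γ ≤ δ ^ 2)
    (hsimple : ∀ i, ∃ t, δ ≤ |wexpect φ (fun x => Y i x * χ t x)|)
    (hpair : ∀ i j, i ≠ j → |wexpect φ (fun x => Y i x * Y j x)| ≤ 4 * γ) :
    (Fintype.card ι : ℚ) * δ ^ 2 ≤ 2 * Fintype.card T := by
  classical
  -- each output's test and sign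
  choose tst htst using hsimple
  let z : ι → ℚ := fun i => if 0 ≤ wexpect φ (fun x => Y i x * χ (tst i) x) then 1 else -1
  have hz : ∀ i, z i = 1 ∨ z i = -1 := fun i => by
    by_cases h : 0 ≤ wexpect φ (fun x => Y i x * χ (tst i) x) <;> simp [z, h]
  have hzsq : ∀ i, z i * z i = 1 := fun i => by rcases hz i with h | h <;> simp [h]
  have hzabs : ∀ i j, |z i * z j| = 1 := fun i j => by
    rcases hz i with h | h <;> rcases hz j with h' | h' <;> simp [h, h']
  have hzcorr : ∀ i, δ ≤ z i * wexpect φ (fun x => Y i x * χ (tst i) x) := by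
    intro i
    have := htst i
    by_cases h : 0 ≤ wexpect φ (fun x => Y i x * χ (tst i) x)
    · simp only [z, h, ↓reduceIte, one_mul]; rwa [abs_of_nonneg h] at this
    · simp only [z, h, ↓reduceIte, neg_mul, one_mul]; rwa [abs_of_neg (lt_of_not_ge h)] at this
  have hYsq : ∀ i x, Y i x * Y i x = 1 := fun i x => by rcases hY i x with h | h <;> simp [h]
  -- the class of a test and its bound `N δ² ≤ 2`
  have hclass : ∀ t : T, (((Finset.univ.filter fun i => tst i = t).card : ℚ)) * δ ^ 2 ≤ 2 := by
    intro t
    set I := Finset.univ.filter fun i => tst i = t with hI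
    set N : ℚ := (I.card : ℚ) with hN
    -- the signed sum Z
    set Z : α → ℚ := fun x => ∑ i ∈ I, z i * Y i x with hZ
    -- (a) E[Z χ_t] ≥ N δ
    have ha : N * δ ≤ wexpect φ (fun x => Z x * χ t x) := by
      have h1 : wexpect φ (fun x => Z x * χ t x) = ∑ i ∈ I, z i * wexpect φ (fun x => Y i x * χ t x) := by
        have : (fun x => Z x * χ t x) = fun x => ∑ i ∈ I, z i * (Y i x * χ t x) := by
          funext x; simp only [hZ, Finset.sum_mul]; exact Finset.sum_congr rfl fun i _ => by ring
        rw [this, wexpect_sum]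
        exact Finset.sum_congr rfl fun i _ => wexpect_const_mul _ _ _
      rw [h1]
      have h2 : ∀ i ∈ I, δ ≤ z i * wexpect φ (fun x => Y i x * χ t x) := by
        intro i hi
        have hit : tst i = t := (Finset.mem_filter.1 hi).2
        rw [← hit]; exact hzcorr i
      calc N * δ = ∑ i ∈ I, δ := by rw [Finset.sum_const, nsmul_eq_mul]
        _ ≤ _ := Finset.sum_le_sum h2
    -- (b) E[Zχ]² ≤ E[Z²]
    have hb := sq_wexpect_mul_le hφ hφ1 Z (χ t) (hχ t)
    -- (c) E[Z²] ≤ N + 4γ N (N - 1)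
    have hc : wexpect φ (fun x => Z x ^ 2) ≤ N + 4 * γ * (N * (N - 1)) := by
      have hexp : wexpect φ (fun x => Z x ^ 2) =
          ∑ i ∈ I, ∑ j ∈ I, z i * z j * wexpect φ (fun x => Y i x * Y j x) := by
        have : (fun x => Z x ^ 2) = fun x => ∑ i ∈ I, ∑ j ∈ I, z i * z j * (Y i x * Y j x) := by
          funext x
          rw [sq, hZ, Finset.sum_mul_sum]
          exact Finset.sum_congr rfl fun i _ => Finset.sum_congr rfl fun j _ => by ring
        rw [this, wexpect_sum]
        refine Finset.sum_congr rfl fun i _ => ?_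
        rw [wexpect_sum]
        exact Finset.sum_congr rfl fun j _ => wexpect_const_mul _ _ _
      rw [hexp]
      -- split the diagonal
      have hsplit : ∀ i ∈ I, (∑ j ∈ I, z i * z j * wexpect φ (fun x => Y i x * Y j x)) ≤ 1 + 4 * γ * (N - 1) := by
        intro i hi
        rw [← Finset.add_sum_erase I _ hi]
        have hdiag : z i * z i * wexpect φ (fun x => Y i x * Y i x) = 1 := by
          rw [hzsq i, one_mul]
          have : (fun x => Y i x * Y i x) = fun _ => (1 : ℚ) := funext (hYsq i)
          rw [this, wexpect_one hφ1]
        rw [hdiag]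
        refine add_le_add le_rfl ?_
        have hoff : ∀ j ∈ I.erase i, z i * z j * wexpect φ (fun x => Y i x * Y j x) ≤ 4 * γ := by
          intro j hj
          have hji : j ≠ i := (Finset.mem_erase.1 hj).1
          calc z i * z j * wexpect φ (fun x => Y i x * Y j x)
              ≤ |z i * z j * wexpect φ (fun x => Y i x * Y j x)| := le_abs_self _
            _ = |z i * z j| * |wexpect φ (fun x => Y i x * Y j x)| := abs_mul _ _
            _ ≤ 1 * (4 * γ) := by rw [hzabs]; exact mul_le_mul_of_nonneg_left (hpair i j hji.symm) zero_le_one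
            _ = 4 * γ := one_mul _
        calc (∑ j ∈ I.erase i, z i * z j * wexpect φ (fun x => Y i x * Y j x))
            ≤ ∑ j ∈ I.erase i, 4 * γ := Finset.sum_le_sum hoff
          _ = ((I.erase i).card : ℚ) * (4 * γ) := by rw [Finset.sum_const, nsmul_eq_mul]
          _ = 4 * γ * (N - 1) := by
              rw [Finset.card_erase_of_mem hi, Nat.cast_sub (Finset.card_pos.2 ⟨i, hi⟩), Nat.cast_one]
              ring
      calc (∑ i ∈ I, ∑ j ∈ I, z i * z j * wexpect φ (fun x => Y i x * Y j x))
          ≤ ∑ i ∈ I, (1 + 4 * γ * (N - 1)) := Finset.sum_le_sum hsplit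
        _ = N * (1 + 4 * γ * (N - 1)) := by rw [Finset.sum_const, nsmul_eq_mul]
        _ = N + 4 * γ * (N * (N - 1)) := by ring
    -- (d) combine
    have hNnn : 0 ≤ N := by rw [hN]; exact Nat.cast_nonneg _
    have hNd : 0 ≤ N * δ := mul_nonneg hNnn hδ.le
    have h4 : (N * δ) ^ 2 ≤ N + 4 * γ * (N * (N - 1)) :=
      (pow_le_pow_left₀ hNd ha 2).trans (hb.trans hc)
    -- N²δ² ≤ N + (δ²/2)·N²  ⇒  N δ² ≤ 2
    by_cases hN0 : I.card = 0
    · have : N = 0 := by rw [hN, hN0, Nat.cast_zero]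
      rw [this, zero_mul]; norm_num
    · have hN1 : (1 : ℚ) ≤ N := by
        rw [hN]; exact_mod_cast Nat.one_le_iff_ne_zero.2 hN0
      have hNpos : 0 < N := lt_of_lt_of_le zero_lt_one hN1
      have hNN : 0 ≤ N * (N - 1) := mul_nonneg hNnn (by linarith)
      have h5 : 4 * γ * (N * (N - 1)) ≤ δ ^ 2 / 2 * (N * (N - 1)) :=
        mul_le_mul_of_nonneg_right (by linarith) hNN
      have h6 : δ ^ 2 / 2 * (N * (N - 1)) ≤ δ ^ 2 / 2 * (N * N) :=
        mul_le_mul_of_nonneg_left (by nlinarith) (by positivity)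
      have h7 : N * (N * δ ^ 2) ≤ N * 2 := by nlinarith [h4, h5, h6]
      exact le_of_mul_le_mul_left h7 hNpos
  -- sum over the classes
  have hcard : (Fintype.card ι : ℚ) = ∑ t : T, ((Finset.univ.filter fun i => tst i = t).card : ℚ) := by
    rw [← Nat.cast_sum, ← Finset.card_univ,
      Finset.card_eq_sum_card_fiberwise (f := tst) (s := Finset.univ) (t := Finset.univ) (fun i _ => Finset.mem_univ _)]
  calc (Fintype.card ι : ℚ) * δ ^ 2 = ∑ t : T, ((Finset.univ.filter fun i => tst i = t).card : ℚ) * δ ^ 2 := by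
        rw [hcard, Finset.sum_mul]
    _ ≤ ∑ _t : T, (2 : ℚ) := Finset.sum_le_sum fun t _ => hclass t
    _ = 2 * Fintype.card T := by rw [Finset.sum_const, nsmul_eq_mul, Finset.card_univ]; ring

/-! ### The hitting-set form [GLW 2025, Thm. 33] -/

section HittingSet

variable {κ : Type*} [Fintype κ] [DecidableEq κ]

/-- The `±1` reading of an output bit (`false ↦ 1`, `true ↦ −1`). [cite: GuruswamiLyuWang2025, §2.1] -/
def pmOne (b : Bool) : ℚ := if b then -1 else 1

/-- `pmOne b` is `1` or `−1`. [cite: GuruswamiLyuWang2025, §2.1] -/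
theorem pmOne_eq_or (b : Bool) : pmOne b = 1 ∨ pmOne b = -1 := by cases b <;> simp [pmOne]

/-- The probability, under weights `D` on output strings, that bits `i, j` read `(a, b)`.
[cite: GuruswamiLyuWang2025, §2.2 (almost pairwise independence)] -/
def pairProb (D : (κ → Bool) → ℚ) (i j : κ) (a b : Bool) : ℚ :=
  ∑ y, D y * (if y i = a ∧ y j = b then 1 else 0)

/-- **`γ`-almost pairwise independence** of a distribution on `{0,1}^κ`: every pair of distinct
coordinates takes each of its four values with probability within `γ` of `1/4`.
[cite: GuruswamiLyuWang2025, §2.2 (ε-almost pairwise independent distribution)] -/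
def IsAlmostPairwiseIndependent (γ : ℚ) (D : (κ → Bool) → ℚ) : Prop :=
  ∀ i j, i ≠ j → ∀ a b, |pairProb D i j a b - 1 / 4| ≤ γ

/-- Almost pairwise independence bounds pairwise correlations: `|E_D[Y_i Y_j]| ≤ 4γ`.
[cite: GuruswamiLyuWang2025, Thm. 33 (proof, last step)] -/
theorem abs_corr_le_of_isAlmostPairwiseIndependent {γ : ℚ} {D : (κ → Bool) → ℚ}
    (hD : IsAlmostPairwiseIndependent γ D) {i j : κ} (hij : i ≠ j) :
    |∑ y, D y * (pmOne (y i) * pmOne (y j))| ≤ 4 * γ := by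
  have hpt : ∀ y : κ → Bool, pmOne (y i) * pmOne (y j) =
      (if y i = true ∧ y j = true then (1 : ℚ) else 0) + (if y i = false ∧ y j = false then (1 : ℚ) else 0)
      - (if y i = true ∧ y j = false then (1 : ℚ) else 0) - (if y i = false ∧ y j = true then (1 : ℚ) else 0) := by
    intro y; cases y i <;> cases y j <;> simp [pmOne]
  have hsum : (∑ y, D y * (pmOne (y i) * pmOne (y j))) =
      pairProb D i j true true + pairProb D i j false false
      - pairProb D i j true false - pairProb D i j false true := by
    simp only [hpt, mul_add, mul_sub, Finset.sum_add_distrib, Finset.sum_sub_distrib, pairProb]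
  rw [hsum]
  have h1 := hD i j hij true true
  have h2 := hD i j hij false false
  have h3 := hD i j hij true false
  have h4 := hD i j hij false true
  rw [abs_le] at h1 h2 h3 h4 ⊢
  constructor <;> linarith [h1.1, h1.2, h2.1, h2.2, h3.1, h3.2, h4.1, h4.2]

variable {α T : Type*} [Fintype α] [DecidableEq α] [Fintype T] [DecidableEq T]

/-- **GLW Theorem 33 (hitting sets from simplicity).**  Let `C : α → {0,1}^κ` be any map whose every
output bit is `δ`-correlated, under EVERY input distribution, with some `±1` test from a family `T`
(GLW: `(d, δ)`-simple outputs, `T` = parities on `≤ d` inputs), with `|κ|·δ² > 2|T|` and `8γ ≤ δ²`.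
Then the support of ANY `γ`-almost pairwise independent distribution `D` on `{0,1}^κ` contains a
string outside `Range(C)` — it is a hitting set for `AVOID(C)`, oblivious to `C`.  (Proof as printed:
were `supp D ⊆ Range(C)`, pulling `D` back along chosen preimages gives an input distribution under
which `C` samples `D`, contradicting the core inequality.) [cite: GuruswamiLyuWang2025, Thm. 33] -/
theorem exists_mem_support_not_mem_range (C : α → κ → Bool) (χ : T → α → ℚ)
    (hχ : ∀ t x, χ t x = 1 ∨ χ t x = -1) {δ γ : ℚ} (hδ : 0 < δ) (hγ : 8 * γ ≤ δ ^ 2)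
    (hsimple : ∀ φ : α → ℚ, (∀ x, 0 ≤ φ x) → ∑ x, φ x = 1 →
      ∀ i : κ, ∃ t, δ ≤ |wexpect φ (fun x => pmOne (C x i) * χ t x)|)
    (hbig : 2 * (Fintype.card T : ℚ) < Fintype.card κ * δ ^ 2)
    (D : (κ → Bool) → ℚ) (hD0 : ∀ y, 0 ≤ D y) (hD1 : ∑ y, D y = 1)
    (hD : IsAlmostPairwiseIndependent γ D) :
    ∃ y, 0 < D y ∧ y ∉ Set.range C := by
  classical
  by_contra hnone
  push Not at hnone
  -- some string carries mass, so `α` is nonempty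
  obtain ⟨y₀, hy₀⟩ : ∃ y, 0 < D y := by
    by_contra hall
    push Not at hall
    have : (∑ y, D y) ≤ 0 := Finset.sum_nonpos fun y _ => hall y
    linarith
  obtain ⟨x₀, -⟩ := hnone y₀ hy₀
  -- chosen preimages
  let pre : (κ → Bool) → α := fun y => if h : y ∈ Set.range C then h.choose else x₀
  have hpre : ∀ y, 0 < D y → C (pre y) = y := by
    intro y hy
    have h : y ∈ Set.range C := hnone y hy
    simp only [pre, h, dif_pos]
    exact h.choose_spec
  -- D y * g(C(pre y)) = D y * g y  (both vanish when D y = 0)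
  have hterm : ∀ (g : (κ → Bool) → ℚ) (y : κ → Bool), D y * g (C (pre y)) = D y * g y := by
    intro g y
    by_cases hy : 0 < D y
    · rw [hpre y hy]
    · have : D y = 0 := le_antisymm (not_lt.1 hy) (hD0 y)
      simp [this]
  -- the pulled-back input distribution
  let φ : α → ℚ := fun x => ∑ y ∈ Finset.univ.filter (fun y => pre y = x), D y
  have hφ0 : ∀ x, 0 ≤ φ x := fun x => Finset.sum_nonneg fun y _ => hD0 y
  -- E_φ[g ∘ C] = E_D[g]
  have hpush : ∀ g : (κ → Bool) → ℚ, wexpect φ (fun x => g (C x)) = ∑ y, D y * g y := by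
    intro g
    unfold wexpect
    have h1 : ∀ x, φ x * g (C x) = ∑ y ∈ Finset.univ.filter (fun y => pre y = x), D y * g (C (pre y)) := by
      intro x
      show (∑ y ∈ Finset.univ.filter (fun y => pre y = x), D y) * g (C x) = _
      rw [Finset.sum_mul]
      exact Finset.sum_congr rfl fun y hy => by rw [(Finset.mem_filter.1 hy).2]
    simp only [h1]
    rw [Finset.sum_fiberwise Finset.univ pre (fun y => D y * g (C (pre y)))]
    exact Finset.sum_congr rfl fun y _ => hterm g y
  have hφ1 : (∑ x, φ x) = 1 := by
    have := hpush (fun _ => 1)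
    simp only [wexpect, mul_one] at this
    rw [this, hD1]
  -- apply the core inequality to Y_i x = pmOne (C x i)
  have hcore := card_mul_sq_le_of_correlated_of_pairwise (ι := κ) hφ0 hφ1
    (fun i x => pmOne (C x i)) (fun i x => pmOne_eq_or _) χ hχ hδ hγ
    (hsimple φ hφ0 hφ1)
    (fun i j hij => by
      have := hpush (fun y => pmOne (y i) * pmOne (y j))
      rw [this]
      exact abs_corr_le_of_isAlmostPairwiseIndependent hD hij)
  linarith

end HittingSet

end GLWHitting

/-! ### Local maps whose tables are simple: Theorem 33 as GLW state it for `NC⁰ₖ`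
[GLW 2025, Thm. 33 with Def. 32]

GLW's Theorem 33 is printed for an `NC⁰ₖ` circuit `C : {0,1}ⁿ → {0,1}ᵐ` each of whose output functions is
`(d, δ)`-simple with respect to EVERY distribution over the inputs, the tests being the parities `χ_R`,
`R ⊆ [n]`, `|R| ≤ d` (so `|T| = Σ_{i ≤ d} C(n,i) ≤ (n+1)^d` and the stretch condition reads
`m·δ² > 2·Σ_{i≤d} C(n,i)`).  Simplicity of the `k`-bit TABLE under every distribution on the `k`-cube
(`IsSimple` of file `SignDegreeSimple`, GLW Def. 32 restricted to the read bits) transfers to the output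
function under every input distribution by pushing the input distribution forward to the read bits
(`LocalMap.readDist`); a position read an even number of times drops out of the parity
(`LocalMap.chiQ_readBits`).  With `exists_isSimple_of_signDegLE` (sign-degree `≤ d` ⇒ simple) and the
finiteness of the set of `k`-bit tables this gives the form quoted in the range-avoidance literature:
ONE constant `δ = δ(k,d) > 0` such that for all `n, m` and every `k`-local map whose tables have
sign-degree `≤ d`, the support of any `γ`-almost pairwise independent distribution (`8γ ≤ δ²`) on
`{0,1}ᵐ` contains a non-image as soon as `m·δ² > 2(n+1)^d` (`LocalMap.hittingSet_of_signDegLE`).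

* `LocalMap.exists_mem_support_not_mem_range_of_isSimple` — Thm. 33 for `LocalMap k n m` with
  `(d, δ)`-simple tables, threshold `m·δ² > 2·|{R ⊆ [n] : |R| ≤ d}|`;
* `card_lowSet_le` — `|{R ⊆ [n] : |R| ≤ d}| ≤ (n+1)^d`;
* `exists_delta_isSimple_of_signDegLE` — a uniform `δ(k,d) > 0` for all `k`-bit tables of sign-degree `≤ d`;
* `LocalMap.hittingSet_of_signDegLE` — the sign-degree form at stretch `m·δ² > 2(n+1)^d`.
-/

section LocalMaps

open GLWHitting

variable {k n m : ℕ}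

/-- `pmOne` (this file) and `bsgn` (file `SignDegreeSimple`) are the same `±1` reading of a bit
(`false ↦ 1`, `true ↦ −1`). [cite: GuruswamiLyuWang2025, §2.1] -/
theorem GLWHitting.pmOne_eq_bsgn (b : Bool) : pmOne b = bsgn b := rfl

/-- `(−1)^{c·b} = (−1)^b` for odd `c` and `= 1` for even `c`. [folklore] -/
private theorem bsgn_pow_eq (b : Bool) (c : ℕ) : bsgn b ^ c = if Odd c then bsgn b else 1 := by
  have hsq : bsgn b ^ 2 = 1 := by rcases bsgn_eq_or b with h | h <;> simp [h]
  rcases Nat.even_or_odd c with hc | hc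
  · rw [if_neg (Nat.not_odd_iff_even.2 hc)]
    obtain ⟨t, rfl⟩ := hc
    rw [← two_mul, pow_mul, hsq, one_pow]
  · rw [if_pos hc]
    obtain ⟨t, rfl⟩ := hc
    rw [pow_succ, pow_mul, hsq, one_pow, one_mul]

/-- `Σ_{i ≤ d} n^i ≤ (n+1)^d`. [folklore] -/
private theorem sum_range_pow_le_succ_pow (n d : ℕ) : ∑ i ∈ Finset.range (d + 1), n ^ i ≤ (n + 1) ^ d := by
  induction d with
  | zero => simp
  | succ d ih =>
    rw [Finset.sum_range_succ, pow_succ (n + 1)]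
    have h1 : n ^ (d + 1) ≤ (n + 1) ^ d * n := by
      rw [pow_succ]; exact Nat.mul_le_mul_right n (Nat.pow_le_pow_left (Nat.le_succ n) d)
    calc ∑ i ∈ Finset.range (d + 1), n ^ i + n ^ (d + 1) ≤ (n + 1) ^ d + (n + 1) ^ d * n :=
          add_le_add ih h1
      _ = (n + 1) ^ d * (n + 1) := by ring

/-- The number of parity tests on at most `d` of `n` positions: `|{R ⊆ [n] : |R| ≤ d}| = Σ_{i≤d} C(n,i)
≤ (n+1)^d` (GLW bound it by `n^d` for `n ≥ 2`). [cite: GuruswamiLyuWang2025, Thm. 33 (the count `|T|`)] -/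
theorem card_lowSet_le (n d : ℕ) : Fintype.card {R : Finset (Fin n) // R.card ≤ d} ≤ (n + 1) ^ d := by
  classical
  have hcard : Fintype.card {R : Finset (Fin n) // R.card ≤ d} =
      ((Finset.range (d + 1)).biUnion fun i => Finset.powersetCard i (Finset.univ : Finset (Fin n))).card := by
    refine Fintype.card_of_subtype _ fun S => ?_
    simp only [Finset.mem_biUnion, Finset.mem_range, Finset.mem_powersetCard, Finset.subset_univ, true_and,
      Nat.lt_succ_iff]
    constructor
    · rintro ⟨i, hi, rfl⟩; exact hi
    · intro h; exact ⟨S.card, h, rfl⟩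
  rw [hcard]
  calc ((Finset.range (d + 1)).biUnion fun i => Finset.powersetCard i (Finset.univ : Finset (Fin n))).card
      ≤ ∑ i ∈ Finset.range (d + 1), (Finset.powersetCard i (Finset.univ : Finset (Fin n))).card :=
        Finset.card_biUnion_le
    _ = ∑ i ∈ Finset.range (d + 1), n.choose i := by
        simp [Finset.card_powersetCard, Finset.card_univ, Fintype.card_fin]
    _ ≤ ∑ i ∈ Finset.range (d + 1), n ^ i := Finset.sum_le_sum fun i _ => Nat.choose_le_pow n i
    _ ≤ (n + 1) ^ d := sum_range_pow_le_succ_pow n d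

/-- **A uniform simplicity constant for `k`-bit tables of sign-degree `≤ d`**: since there are finitely many
tables on `k` bits, one `δ = δ(k, d) > 0` makes every table of sign-degree `≤ d` `(d, δ)`-simple
(GLW Lemmas 34–35 compute such constants for `k`-LTFs and for functions with `k^{−γ}`-approximate degree `d`).
[cite: GuruswamiLyuWang2025, Def. 32, Lemmas 34–35] [cite: AspnesEtAl1994, §2] -/
theorem exists_delta_isSimple_of_signDegLE (k d : ℕ) :
    ∃ δ : ℚ, 0 < δ ∧ ∀ P : (Fin k → Bool) → Bool, SignDegLE d P → IsSimple d δ P := by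
  classical
  have key : ∀ P : (Fin k → Bool) → Bool, ∃ δ : ℚ, 0 < δ ∧ (SignDegLE d P → IsSimple d δ P) := by
    intro P
    by_cases h : SignDegLE d P
    · obtain ⟨δ, hδ, hs⟩ := exists_isSimple_of_signDegLE h
      exact ⟨δ, hδ, fun _ => hs⟩
    · exact ⟨1, one_pos, fun h' => (h h').elim⟩
  choose f hf0 hfP using key
  have hne : (Finset.univ : Finset ((Fin k → Bool) → Bool)).Nonempty := ⟨fun _ => true, Finset.mem_univ _⟩
  refine ⟨Finset.univ.inf' hne f, (Finset.lt_inf'_iff hne).2 fun P _ => hf0 P, fun P hP => ?_⟩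
  exact (hfP P hP).mono le_rfl (Finset.inf'_le f (Finset.mem_univ P))

namespace LocalMap

/-- The `k` bits read by output `j` on input `x`. [folklore] -/
def readBits (C : LocalMap k n m) (j : Fin m) (x : Fin n → Bool) : Fin k → Bool :=
  fun i => x (C.vars j i)

/-- `C(x)_j = table_j (readBits_j x)`. [folklore] -/
private theorem eval_eq_table_readBits (C : LocalMap k n m) (x : Fin n → Bool) (j : Fin m) :
    C.eval x j = C.table j (C.readBits j x) := rfl

/-- The input positions read an ODD number of times by the coordinates `S` of output `j`: the parity of
the read bits indexed by `S` is the parity of the input bits at these positions. [folklore] -/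
def oddRead (C : LocalMap k n m) (j : Fin m) (S : Finset (Fin k)) : Finset (Fin n) :=
  (S.image (C.vars j)).filter fun v => Odd (S.filter fun i => C.vars j i = v).card

/-- `|oddRead_j S| ≤ |S|`: the input parity seen by a table parity `χ_S` has at most `|S|` positions
(GLW: output `i` of an `NC⁰ₖ` circuit correlates with «χ_S for some `|S| ≤ d`» over the inputs it reads).
[cite: GuruswamiLyuWang2025, Thm. 33 (proof)] -/
theorem card_oddRead_le (C : LocalMap k n m) (j : Fin m) (S : Finset (Fin k)) :
    (C.oddRead j S).card ≤ S.card :=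
  (Finset.card_filter_le _ _).trans Finset.card_image_le

/-- `χ_S(readBits_j x) = χ_{oddRead_j S}(x)` — the parity of the read bits indexed by `S` is a parity of
at most `|S|` INPUT positions (a position read twice cancels). [cite: GuruswamiLyuWang2025, Thm. 33 (proof)] -/
theorem chiQ_readBits (C : LocalMap k n m) (j : Fin m) (S : Finset (Fin k)) (x : Fin n → Bool) :
    chiQ S (C.readBits j x) = chiQ (C.oddRead j S) x := by
  unfold chiQ oddRead readBits
  rw [Finset.prod_filter, Finset.prod_comp (fun v => bsgn (x v)) (C.vars j)]
  exact Finset.prod_congr rfl fun v _ => bsgn_pow_eq _ _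

/-- The distribution of the `k` read bits of output `j` under an input distribution `φ` (push-forward;
GLW's «any distribution φ over the inputs» seen through the bits output `j` reads).
[cite: GuruswamiLyuWang2025, Def. 32] -/
def readDist (C : LocalMap k n m) (j : Fin m) (φ : (Fin n → Bool) → ℚ) (hφ0 : ∀ x, 0 ≤ φ x)
    (hφ1 : ∑ x, φ x = 1) : CubeDist k where
  wt u := ∑ x ∈ Finset.univ.filter (fun x => C.readBits j x = u), φ x
  nonneg _ := Finset.sum_nonneg fun x _ => hφ0 x
  total := by rw [Finset.sum_fiberwise Finset.univ (C.readBits j) φ, hφ1]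

/-- Expectations under the push-forward are expectations under `φ` of the pulled-back function.
[cite: GuruswamiLyuWang2025, Def. 32] -/
theorem readDist_expect (C : LocalMap k n m) (j : Fin m) (φ : (Fin n → Bool) → ℚ) (hφ0 : ∀ x, 0 ≤ φ x)
    (hφ1 : ∑ x, φ x = 1) (g : (Fin k → Bool) → ℚ) :
    ∑ u, (C.readDist j φ hφ0 hφ1).wt u * g u = ∑ x, φ x * g (C.readBits j x) := by
  show ∑ u, (∑ x ∈ Finset.univ.filter (fun x => C.readBits j x = u), φ x) * g u = _
  have h1 : ∀ u, (∑ x ∈ Finset.univ.filter (fun x => C.readBits j x = u), φ x) * g u =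
      ∑ x ∈ Finset.univ.filter (fun x => C.readBits j x = u), φ x * g (C.readBits j x) := by
    intro u
    rw [Finset.sum_mul]
    exact Finset.sum_congr rfl fun x hx => by rw [(Finset.mem_filter.1 hx).2]
  simp only [h1]
  exact Finset.sum_fiberwise Finset.univ (C.readBits j) (fun x => φ x * g (C.readBits j x))

/-- The correlation of the TABLE with `χ_S` under the push-forward equals the correlation of the OUTPUT
with the input parity `χ_{oddRead_j S}` under `φ`. [cite: GuruswamiLyuWang2025, Def. 32 / Thm. 33] -/
theorem corr_readDist (C : LocalMap k n m) (j : Fin m) (φ : (Fin n → Bool) → ℚ) (hφ0 : ∀ x, 0 ≤ φ x)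
    (hφ1 : ∑ x, φ x = 1) (S : Finset (Fin k)) :
    corr (C.readDist j φ hφ0 hφ1) (C.table j) S =
      wexpect φ (fun x => pmOne (C.eval x j) * chiQ (C.oddRead j S) x) := by
  unfold corr wexpect
  rw [readDist_expect]
  refine Finset.sum_congr rfl fun x _ => ?_
  simp only [chiQ_readBits, eval_eq_table_readBits, pmOne_eq_bsgn]

/-- **Simple tables give simple outputs**: if table `j` is `(d, δ)`-simple on the `k`-cube, then under
every input distribution output `j` is `δ`-correlated with a parity of at most `d` INPUT positions.
[cite: GuruswamiLyuWang2025, Def. 32 / Thm. 33] -/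
theorem exists_lowSet_corr_of_isSimple (C : LocalMap k n m) {d : ℕ} {δ : ℚ} {j : Fin m}
    (hs : IsSimple d δ (C.table j)) (φ : (Fin n → Bool) → ℚ) (hφ0 : ∀ x, 0 ≤ φ x) (hφ1 : ∑ x, φ x = 1) :
    ∃ R : {R : Finset (Fin n) // R.card ≤ d}, δ ≤ |wexpect φ (fun x => pmOne (C.eval x j) * chiQ R.1 x)| := by
  obtain ⟨S, hS, hδ⟩ := hs (C.readDist j φ hφ0 hφ1)
  exact ⟨⟨C.oddRead j S, (C.card_oddRead_le j S).trans hS⟩, by rwa [corr_readDist] at hδ⟩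

/-- **GLW Theorem 33 for `k`-local maps with `(d, δ)`-simple tables.**  If every table of
`C : {0,1}ⁿ → {0,1}ᵐ` is `(d, δ)`-simple, `8γ ≤ δ²` and `m·δ² > 2·|{R ⊆ [n] : |R| ≤ d}|`, then the support
of ANY `γ`-almost pairwise independent distribution `D` on `{0,1}ᵐ` contains a string outside `Range(C)`
(an oblivious hitting set for `NC⁰ₖ-AVOID` on such instances; GLW: poly-size supports exist by [AGHP92],
whence an `FP^NP` algorithm). [cite: GuruswamiLyuWang2025, Thm. 33] -/
theorem exists_mem_support_not_mem_range_of_isSimple (C : LocalMap k n m) {d : ℕ} {δ γ : ℚ}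
    (hδ : 0 < δ) (hγ : 8 * γ ≤ δ ^ 2) (hs : ∀ j, IsSimple d δ (C.table j))
    (hbig : 2 * (Fintype.card {R : Finset (Fin n) // R.card ≤ d} : ℚ) < m * δ ^ 2)
    (D : (Fin m → Bool) → ℚ) (hD0 : ∀ y, 0 ≤ D y) (hD1 : ∑ y, D y = 1)
    (hD : IsAlmostPairwiseIndependent γ D) :
    ∃ y, 0 < D y ∧ y ∉ C.range := by
  classical
  have hχ : ∀ (R : {R : Finset (Fin n) // R.card ≤ d}) (x : Fin n → Bool), chiQ R.1 x = 1 ∨ chiQ R.1 x = -1 :=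
    fun R x => (abs_eq zero_le_one).1 (abs_chiQ R.1 x)
  have hbig' : 2 * (Fintype.card {R : Finset (Fin n) // R.card ≤ d} : ℚ) < Fintype.card (Fin m) * δ ^ 2 := by
    rwa [Fintype.card_fin]
  exact exists_mem_support_not_mem_range C.eval (fun (R : {R : Finset (Fin n) // R.card ≤ d}) x => chiQ R.1 x) hχ hδ hγ
    (fun φ hφ0 hφ1 j => C.exists_lowSet_corr_of_isSimple (hs j) φ hφ0 hφ1) hbig' D hD0 hD1 hD

/-- **The sign-degree form** (how the range-avoidance literature quotes Thm. 33 for `NC⁰ₖ[deg_± ≤ d]`,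
e.g. `k`-LTF gates, `d = 1`): there is ONE constant `δ = δ(k, d) > 0` such that for all `n, m`, every
`k`-local map `C : {0,1}ⁿ → {0,1}ᵐ` all of whose tables have sign-degree `≤ d`, every `γ` with `8γ ≤ δ²`
and every `γ`-almost pairwise independent distribution `D` on `{0,1}ᵐ`: if `m·δ² > 2(n+1)^d` then
`supp D ⊄ Range(C)`. [cite: GuruswamiLyuWang2025, Thm. 33 with Lemmas 34–35] -/
theorem hittingSet_of_signDegLE (k d : ℕ) : ∃ δ : ℚ, 0 < δ ∧
    ∀ {n m : ℕ} (C : LocalMap k n m), (∀ j, SignDegLE d (C.table j)) →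
    ∀ γ : ℚ, 8 * γ ≤ δ ^ 2 → 2 * ((n + 1) ^ d : ℚ) < m * δ ^ 2 →
    ∀ D : (Fin m → Bool) → ℚ, (∀ y, 0 ≤ D y) → ∑ y, D y = 1 → IsAlmostPairwiseIndependent γ D →
    ∃ y, 0 < D y ∧ y ∉ C.range := by
  obtain ⟨δ, hδ, hall⟩ := exists_delta_isSimple_of_signDegLE k d
  refine ⟨δ, hδ, fun C hC γ hγ hbig D hD0 hD1 hD => ?_⟩
  refine C.exists_mem_support_not_mem_range_of_isSimple hδ hγ (fun j => hall _ (hC j)) ?_ D hD0 hD1 hD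
  exact lt_of_le_of_lt (mul_le_mul_of_nonneg_left (by exact_mod_cast card_lowSet_le _ d) zero_le_two) hbig

end LocalMap

end LocalMaps

end Literature.Computability.Complexity
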